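import Summits.CriticalPhenomena.CardyFormulaZ2.Theorems.CardySusyWardParafermionFamiliesToSLESixAnchoredWallFluxPhase
import Summits.CriticalPhenomena.CardyFormulaZ2.Theorems.CardySusyWardParafermionFamiliesToSLESixAnchoredWallFluxDarts
import Summits.CriticalPhenomena.CardyFormulaZ2.Theorems.CardySusyWardParafermionFamiliesToSLESixAnchoredWallFluxArm

/-!
# The strip anchor (stub S5 of line `strip-anchored-vertex-normalisation`, crux stmt-CriticalPhenomena-10814), VI:
# WALL PACKAGE — one phase along the free-wall window, and the two flux darts of every window site

Helper file for `stub_anchoredWallFlux` (conditional form `IkhlefPonsaingFirstPassage → AnchoredWallFlux`).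
On the discretised diagonal square of size `L ≥ 8` — in level/column coordinates `s = v₀ + v₁`,
`d = v₀ - v₁`: mesh domain `{|s| ≤ L, |d| ≤ L}` with full lattice adjacency, discrete boundary the layer
`L - 1 ≤ |s| ∨ L - 1 ≤ |d|`, inner faces `{|f₀ + f₁ + 1| < L, |d| < L}`, and the boundary sites of level
`≥ L - 1` in the middle half `4|d| ≤ 3L` on the FREE arc `B` only (the geometry package of
`S5.anchor_geometry`, taken as hypotheses) — the WINDOW is the set of sites `w` of level `L - 2` with
`2|d| ≤ L + 2`, just under the free wall.

* `wall_site` (Step 1): every window site is a free-wall site — faces `w`, `w - e₀`, `w - e₀ + e₁` inner,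
  face `w + e₀` not inner, `w + e₀, w + e₁, w + e₀ + e₁ ∈ B`, `w ∉ A` — and the two lattice edges
  `s(w, w - e₀)`, `s(w - e₀, w - e₀ + e₁)` are open in the completed all-open configuration
  `E.bcBondConfig Set.univ` (domain edges with no endpoint on the boundary). Pure `omega` bookkeeping.
* `touch_univ`, `turnCount_shift_univ` (Step 2): a window site joined to the wired arc `A` in some
  configuration is touched by the exploration of the all-open configuration (TouchModulus
  `touch_of_reachable` + monotonicity of `bcBondConfig`), and the turn counts at the all-open touches of
  two consecutive window sites `w`, `w - e₀ + e₁` agree (`touch_shift` + TouchPhase `turnCount_touch`).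
* `wall_phase_package` (Step 3, the statement consumed by the assembly of `stub_anchoredWallFlux_of_IP`):
  ONE integer `τ` — the turn count at the all-open touch of the central window site, propagated along the
  window by induction on the column distance to the centre — such that at every window site the two flux
  corners are `G(w, w - e₀) = sixthPhase (τ + 1) · P(w ↔ A)` and `G(w, w - e₁) = sixthPhase (τ - 1) · P(w ↔ A)`
  (`cornerObs_touch_out/in` on the event `{touch} = {w ↔ A}`, `touch_iff`).
* Registered one-line ticket `stub_anchor_window` (additivity of the diamond column `col`).
-/

noncomputable section

namespace Summit.CriticalPhenomena.CardyFormulaZ2.Theorems.ParafermionFamiliesToSLESix.StripAnchored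

open MeasureTheory Function
open Literature.Probability.Percolation (bondPercolation half BondConfig)
open Literature.Probability.Percolation.TrackExchange (col)
open Literature.Probability.LatticeModels
open Literature.Probability.LatticeModels.DiscreteDobrushin (startCorner exitTime isStartCorner_startCorner
  isInnerFace_of_lt_exitTime not_isInnerFace_exitTime)
open Summit.CriticalPhenomena.CardyFormulaZ2.Cruxes.EdgePrecompact.QkzStripBoundaryArm (cornerObs)
open S2 (sixthPhase)

/-- **Registered ticket `stub_anchor_window`**: the diamond column `col x = x₀ - x₁` is additive. [folklore] -/
theorem stub_anchor_window : ∀ (x y : Site 2), col (x + y) = col x + col y := by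
  intro x y
  simp only [col, Pi.add_apply]
  ring

namespace S5

variable {E : DiscreteDobrushin} {L : ℤ}

/-- `2|d| ≤ M` written linearly. [folklore] -/
theorem two_mul_abs_le {d M : ℤ} : 2 * |d| ≤ M ↔ 2 * d ≤ M ∧ -M ≤ 2 * d := by
  rcases abs_cases d with ⟨h, _⟩ | ⟨h, _⟩ <;> rw [h] <;> omega

/-! ## Step 1: the wall-site structure of a window site -/

/-- Coordinates of the sites around a wall site `w`. [folklore] -/
theorem wall_coords (w : Site 2) :
    (w + cornerUnit 0) 0 = w 0 + 1 ∧ (w + cornerUnit 0) 1 = w 1 ∧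
    (w + cornerUnit 1) 0 = w 0 ∧ (w + cornerUnit 1) 1 = w 1 + 1 ∧
    (w - cornerUnit 0) 0 = w 0 - 1 ∧ (w - cornerUnit 0) 1 = w 1 ∧
    (w - cornerUnit 1) 0 = w 0 ∧ (w - cornerUnit 1) 1 = w 1 - 1 ∧
    (w + cornerUnit 0 + cornerUnit 1) 0 = w 0 + 1 ∧ (w + cornerUnit 0 + cornerUnit 1) 1 = w 1 + 1 ∧
    (w - cornerUnit 0 + cornerUnit 1) 0 = w 0 - 1 ∧ (w - cornerUnit 0 + cornerUnit 1) 1 = w 1 + 1 ∧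
    (w + cornerUnit 0 - cornerUnit 1) 0 = w 0 + 1 ∧ (w + cornerUnit 0 - cornerUnit 1) 1 = w 1 - 1 := by
  simp

/-- **The wall-site structure of a window site.** On the discretised diagonal square of size `L ≥ 8`
(mesh domain `{|s| ≤ L, |d| ≤ L}` in level/column coordinates `s = v₀ + v₁`, `d = v₀ - v₁`, full
lattice adjacency, boundary layer `L - 1 ≤ |s| ∨ L - 1 ≤ |d|`, inner faces `|f₀ + f₁ + 1| < L ∧ |d| < L`,
free arc through the middle half of the top side), a site `w` of level `L - 2` with `2|d| ≤ L + 2` (the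
WINDOW, written linearly) is a
free-wall site: the faces `w`, `w - e₀`, `w - e₀ + e₁` are inner, the face `w + e₀` is not, the sites
`w + e₀`, `w + e₁`, `w + e₀ + e₁` lie on the arc `B`, `w ∉ A`, and the two edges `s(w, w - e₀)`,
`s(w - e₀, w - e₀ + e₁)` are open in the completed all-open configuration. [folklore] -/
theorem wall_site (hL : 8 ≤ L)
    (hmesh : ∀ v : Site 2, v ∈ meshDomain E.Ω E.δ ↔ |v 0 + v 1| ≤ L ∧ |v 0 - v 1| ≤ L)
    (hadj : ∀ v u : Site 2, v ∈ meshDomain E.Ω E.δ → u ∈ meshDomain E.Ω E.δ → (zdGraph 2).Adj v u →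
      (discreteDomainGraph E.Ω E.δ).Adj v u)
    (hbd : ∀ v : Site 2, v ∈ E.zdBoundary ↔
      (|v 0 + v 1| ≤ L ∧ |v 0 - v 1| ≤ L) ∧ (L - 1 ≤ |v 0 + v 1| ∨ L - 1 ≤ |v 0 - v 1|))
    (hface : ∀ f : Site 2, E.IsInnerFace f ↔ |f 0 + f 1 + 1| < L ∧ |f 0 - f 1| < L)
    (harcB : ∀ v : Site 2, v ∈ E.zdBoundary → L - 1 ≤ v 0 + v 1 → 4 * |v 0 - v 1| ≤ 3 * L →
      v ∈ E.zdArcB ∧ v ∉ E.zdArcA)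
    {w : Site 2} (hs : w 0 + w 1 = L - 2) (hd1 : 2 * (w 0 - w 1) ≤ L + 2) (hd2 : -(L + 2) ≤ 2 * (w 0 - w 1)) :
    E.IsInnerFace w ∧ E.IsInnerFace (w - cornerUnit 0) ∧ E.IsInnerFace (w - cornerUnit 0 + cornerUnit 1) ∧
      ¬ E.IsInnerFace (w + cornerUnit 0) ∧
      w + cornerUnit 0 ∈ E.zdArcB ∧ w + cornerUnit 1 ∈ E.zdArcB ∧ w + cornerUnit 0 + cornerUnit 1 ∈ E.zdArcB ∧
      w ∉ E.zdArcA ∧ s(w, w - cornerUnit 0) ∈ E.bcBondConfig Set.univ ∧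
      s(w - cornerUnit 0, w - cornerUnit 0 + cornerUnit 1) ∈ E.bcBondConfig Set.univ := by
  obtain ⟨a0, a1, b0, b1, c0, c1, -, -, d0, d1, f0, f1, -⟩ := wall_coords w
  -- sites of the two top levels in the middle half lie on the arc `B`
  have hB : ∀ v : Site 2, v 0 + v 1 = L - 1 ∨ v 0 + v 1 = L → 4 * (v 0 - v 1) ≤ 3 * L →
      -(3 * L) ≤ 4 * (v 0 - v 1) → v ∈ E.zdArcB := by
    intro v hv h1 h2
    have h4 : 4 * |v 0 - v 1| ≤ 3 * L := by
      rcases abs_cases (v 0 - v 1) with ⟨h, -⟩ | ⟨h, -⟩ <;> rw [h] <;> omega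
    refine (harcB v ((hbd v).2 ⟨⟨?_, ?_⟩, Or.inl ?_⟩) (by omega) h4).1
    · rw [abs_le]; omega
    · rw [abs_le]; omega
    · rw [le_abs]; omega
  -- sites of levels `L - 2`, `L - 3` and column `< L - 1` are mesh-domain sites off the boundary
  have hnotbd : ∀ v : Site 2, v 0 + v 1 = L - 2 ∨ v 0 + v 1 = L - 3 → v 0 - v 1 < L - 1 →
      -(L - 1) < v 0 - v 1 → v ∉ E.zdBoundary := by
    intro v hv h1 h2 hvb
    have h := ((hbd v).1 hvb).2
    rw [le_abs, le_abs] at h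
    omega
  have hmem : ∀ v : Site 2, v 0 + v 1 = L - 2 ∨ v 0 + v 1 = L - 3 → v 0 - v 1 < L - 1 →
      -(L - 1) < v 0 - v 1 → v ∈ meshDomain E.Ω E.δ := by
    intro v hv h1 h2
    rw [hmesh, abs_le, abs_le]
    omega
  -- hence lattice edges between them are open in the completed all-open configuration
  have hopen : ∀ v u : Site 2, v 0 + v 1 = L - 2 ∨ v 0 + v 1 = L - 3 → v 0 - v 1 < L - 1 →
      -(L - 1) < v 0 - v 1 → u 0 + u 1 = L - 2 ∨ u 0 + u 1 = L - 3 → u 0 - u 1 < L - 1 →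
      -(L - 1) < u 0 - u 1 → (zdGraph 2).Adj v u → s(v, u) ∈ E.bcBondConfig Set.univ := by
    intro v u hv hv1 hv2 hu hu1 hu2 hvu
    rw [DiscreteDobrushin.mem_bcBondConfig_iff]
    refine ⟨(SimpleGraph.mem_edgeSet _).2 (hadj v u (hmem v hv hv1 hv2) (hmem u hu hu1 hu2) hvu),
      Or.inr ⟨Set.mem_univ _, fun x hx => ?_⟩⟩
    rcases Sym2.mem_iff.1 hx with rfl | rfl
    · exact fun h => hnotbd _ hv hv1 hv2 (E.zdArcB_subset_zdBoundary h)
    · exact fun h => hnotbd _ hu hu1 hu2 (E.zdArcB_subset_zdBoundary h)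
  refine ⟨?_, ?_, ?_, ?_, ?_, ?_, ?_, ?_, ?_, ?_⟩
  · rw [hface, abs_lt, abs_lt]; omega
  · rw [hface, abs_lt, abs_lt, c0, c1]; omega
  · rw [hface, abs_lt, abs_lt, f0, f1]; omega
  · rw [hface, abs_lt, a0, a1]; omega
  · exact hB _ (by rw [a0, a1]; omega) (by rw [a0, a1]; omega) (by rw [a0, a1]; omega)
  · exact hB _ (by rw [b0, b1]; omega) (by rw [b0, b1]; omega) (by rw [b0, b1]; omega)
  · exact hB _ (by rw [d0, d1]; omega) (by rw [d0, d1]; omega) (by rw [d0, d1]; omega)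
  · exact fun h => hnotbd w (Or.inl hs) (by omega) (by omega) (E.zdArcA_subset_zdBoundary h)
  · refine hopen _ _ (Or.inl hs) (by omega) (by omega) (by rw [c0, c1]; omega) (by rw [c0, c1]; omega)
      (by rw [c0, c1]; omega) ?_
    have : w - cornerUnit 0 = w + cornerUnit 2 := by
      ext i; fin_cases i <;> simp [sub_eq_add_neg]
    rw [this]; exact zdGraph_adj_add_cornerUnit w 2
  · exact hopen _ _ (by rw [c0, c1]; omega) (by rw [c0, c1]; omega) (by rw [c0, c1]; omega)
      (by rw [f0, f1]; omega) (by rw [f0, f1]; omega) (by rw [f0, f1]; omega) (zdGraph_adj_add_cornerUnit _ 1)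

/-! ## Step 2: one phase along the window, in the all-open configuration -/

section Window

variable (hE : E.IsZdAdmissible) (hH : HoleFree {f : Site 2 | E.IsInnerFace f}) (hL : 8 ≤ L)
  (hmesh : ∀ v : Site 2, v ∈ meshDomain E.Ω E.δ ↔ |v 0 + v 1| ≤ L ∧ |v 0 - v 1| ≤ L)
  (hadj : ∀ v u : Site 2, v ∈ meshDomain E.Ω E.δ → u ∈ meshDomain E.Ω E.δ → (zdGraph 2).Adj v u →
    (discreteDomainGraph E.Ω E.δ).Adj v u)
  (hbd : ∀ v : Site 2, v ∈ E.zdBoundary ↔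
    (|v 0 + v 1| ≤ L ∧ |v 0 - v 1| ≤ L) ∧ (L - 1 ≤ |v 0 + v 1| ∨ L - 1 ≤ |v 0 - v 1|))
  (hface : ∀ f : Site 2, E.IsInnerFace f ↔ |f 0 + f 1 + 1| < L ∧ |f 0 - f 1| < L)
  (harcB : ∀ v : Site 2, v ∈ E.zdBoundary → L - 1 ≤ v 0 + v 1 → 4 * |v 0 - v 1| ≤ 3 * L →
    v ∈ E.zdArcB ∧ v ∉ E.zdArcA)

include hH hL hmesh hadj hbd hface harcB

/-- **A window site joined to the wired arc in some configuration is touched in the all-open one**: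
joined to `A` in `ω`, hence in `Set.univ ⊇ ω` (`bcBondConfig_mono`), hence touched there
(TouchModulus, `touch_of_reachable`). [cite: DuminilCopin2012Parafermion, Proposition 5] -/
theorem touch_univ {w : Site 2} (hs : w 0 + w 1 = L - 2) (hd1 : 2 * (w 0 - w 1) ≤ L + 2)
    (hd2 : -(L + 2) ≤ 2 * (w 0 - w 1))
    (hne : ∃ ω : BondConfig (Site 2), ∃ a ∈ E.zdArcA, (SimpleGraph.fromEdgeSet (E.bcBondConfig ω)).Reachable w a) :
    ∃ n < exitTime hE Set.univ, cornerOrbit (E.bcBondConfig Set.univ) (startCorner hE) n = (w, 0) := by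
  obtain ⟨hw, -, -, hw', -, -, hu, -⟩ := wall_site hL hmesh hadj hbd hface harcB hs hd1 hd2
  obtain ⟨ω₀, a, ha, hreach⟩ := hne
  exact touch_of_reachable hE hH hw hw' hu ha
    (hreach.mono (SimpleGraph.fromEdgeSet_mono (E.bcBondConfig_mono (Set.subset_univ ω₀))))

/-- **The phase does not change along one window step.** In the all-open configuration, touches
`orb n = (w, 0)` and `orb n' = (w - e₀ + e₁, 0)` of two consecutive window sites have the same turn
count: four steps after `n` the exploration touches `w - e₀ + e₁` with the turn count of `n`
(`touch_shift`, the two edges `s(w, w - e₀)`, `s(w - e₀, w - e₀ + e₁)` being open), and two touches of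
the free-wall site `w - e₀ + e₁` have equal turn counts (TouchPhase, `turnCount_touch`).
[cite: Smirnov2010, proof of Lemma 4.5] -/
theorem turnCount_shift_univ {w : Site 2} (hs : w 0 + w 1 = L - 2) (hd1 : 2 * (w 0 - w 1) ≤ L + 2)
    (hd2 : -(L + 2) ≤ 2 * (w 0 - w 1 - 2)) {n n' : ℕ} (hn : n < exitTime hE Set.univ)
    (hn' : n' < exitTime hE Set.univ)
    (h : cornerOrbit (E.bcBondConfig Set.univ) (startCorner hE) n = (w, 0))
    (h' : cornerOrbit (E.bcBondConfig Set.univ) (startCorner hE) n' = (w - cornerUnit 0 + cornerUnit 1, 0)) :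
    turnCount (E.bcBondConfig Set.univ) (startCorner hE) n =
      turnCount (E.bcBondConfig Set.univ) (startCorner hE) n' := by
  obtain ⟨-, hw1, hw2, -, -, hB1, -, -, ho1, ho2⟩ := wall_site hL hmesh hadj hbd hface harcB hs hd1 (by omega)
  obtain ⟨-, -, -, -, -, -, -, -, -, -, f0, f1, -⟩ := wall_coords w
  obtain ⟨-, -, -, hw'', -, -, hu', -⟩ := wall_site hL hmesh hadj hbd hface harcB
    (w := w - cornerUnit 0 + cornerUnit 1) (by rw [f0, f1]; omega) (by rw [f0, f1]; omega) (by rw [f0, f1]; omega)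
  obtain ⟨h4, horb4, htc4⟩ := touch_shift hE hw1 hB1 hw2 hn h ho1 ho2
  rw [← htc4]
  exact turnCount_touch hE hH hw2 hw'' hu' h4 hn' horb4 h'

end Window

/-! ## Step 3: the wall package -/

/-- **`S5.wall_phase_package` (stub WALL PACKAGE).** On the discretised diagonal square of size `L ≥ 8`
with its lattice geometry package (mesh domain, domain adjacency, discrete boundary, inner faces, free
arc through the middle half of the top side) and hole-free inner faces, if every window site
`w` (level `L - 2`, `2|column| ≤ L + 2`) is joined to the wired arc `A` in some configuration, then
there is ONE integer `τ` such that at every window site the two flux corners evaluate to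
`G(w, w - e₀) = sixthPhase (τ + 1) · P(w ↔ A)` and `G(w, w - e₁) = sixthPhase (τ - 1) · P(w ↔ A)`.
Proof: every window site is a free-wall site (`wall_site`); in the all-open configuration every window
site is touched (`touch_univ`), and the turn counts at the touches of consecutive window sites agree
(`turnCount_shift_univ`), so by induction outwards from the central window site they all equal the turn
count `τ` at its touch; TouchPhase (`turnCount_touch`) transfers `τ` to every touch in every
configuration, the flux darts are then `sixthPhase (τ ± 1) · P(touch)` (`cornerObs_touch_out/in`), and
`{touch} = {w ↔ A}` (TouchModulus, `touch_iff`). [cite: DuminilCopin2012Parafermion, Proposition 5] -/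
theorem wall_phase_package {E : DiscreteDobrushin} (hE : E.IsZdAdmissible)
    (hH : HoleFree {f : Site 2 | E.IsInnerFace f}) {L : ℤ} (hL : 8 ≤ L)
    (hmesh : ∀ v : Site 2, v ∈ meshDomain E.Ω E.δ ↔ |v 0 + v 1| ≤ L ∧ |v 0 - v 1| ≤ L)
    (hadj : ∀ v u : Site 2, v ∈ meshDomain E.Ω E.δ → u ∈ meshDomain E.Ω E.δ → (zdGraph 2).Adj v u →
      (discreteDomainGraph E.Ω E.δ).Adj v u)
    (hbd : ∀ v : Site 2, v ∈ E.zdBoundary ↔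
      (|v 0 + v 1| ≤ L ∧ |v 0 - v 1| ≤ L) ∧ (L - 1 ≤ |v 0 + v 1| ∨ L - 1 ≤ |v 0 - v 1|))
    (hface : ∀ f : Site 2, E.IsInnerFace f ↔ |f 0 + f 1 + 1| < L ∧ |f 0 - f 1| < L)
    (harcB : ∀ v : Site 2, v ∈ E.zdBoundary → L - 1 ≤ v 0 + v 1 → 4 * |v 0 - v 1| ≤ 3 * L →
      v ∈ E.zdArcB ∧ v ∉ E.zdArcA)
    (hne : ∀ w : Site 2, w 0 + w 1 = L - 2 → 2 * |w 0 - w 1| ≤ L + 2 →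
      ∃ ω : BondConfig (Site 2), ∃ a ∈ E.zdArcA, (SimpleGraph.fromEdgeSet (E.bcBondConfig ω)).Reachable w a) :
    ∃ τ : ℤ, ∀ w : Site 2, w 0 + w 1 = L - 2 → 2 * |w 0 - w 1| ≤ L + 2 →
      cornerObs E E.δ w (w - cornerUnit 0) = sixthPhase (τ + 1) *
          (((bondPercolation (zdGraph 2) half).real
            {ω : BondConfig (Site 2) | ∃ a ∈ E.zdArcA, (SimpleGraph.fromEdgeSet (E.bcBondConfig ω)).Reachable w a} : ℝ) : ℂ) ∧
      cornerObs E E.δ w (w - cornerUnit 1) = sixthPhase (τ - 1) *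
          (((bondPercolation (zdGraph 2) half).real
            {ω : BondConfig (Site 2) | ∃ a ∈ E.zdArcA, (SimpleGraph.fromEdgeSet (E.bcBondConfig ω)).Reachable w a} : ℝ) : ℂ) := by
  -- Step 2 (a): the window sites are touched in the all-open configuration
  have htouch : ∀ w : Site 2, w 0 + w 1 = L - 2 → 2 * (w 0 - w 1) ≤ L + 2 → -(L + 2) ≤ 2 * (w 0 - w 1) →
      ∃ n < exitTime hE Set.univ, cornerOrbit (E.bcBondConfig Set.univ) (startCorner hE) n = (w, 0) :=
    fun w hs hd1 hd2 => touch_univ hE hH hL hmesh hadj hbd hface harcB hs hd1 hd2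
      (hne w hs (two_mul_abs_le.2 ⟨hd1, hd2⟩))
  -- Step 2 (b): the central window site (column `0` or `1`) and the phase `τ` of its touch
  obtain ⟨wc, hsc, hdc⟩ : ∃ wc : Site 2, wc 0 + wc 1 = L - 2 ∧ (wc 0 - wc 1 = 0 ∨ wc 0 - wc 1 = 1) := by
    obtain ⟨k, hk | hk⟩ := Int.even_or_odd' L
    · exact ⟨![k - 1, k - 1], show k - 1 + (k - 1) = L - 2 by omega, Or.inl (show k - 1 - (k - 1) = 0 by omega)⟩
    · exact ⟨![k, k - 1], show k + (k - 1) = L - 2 by omega, Or.inr (show k - (k - 1) = 1 by omega)⟩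
  obtain ⟨nc, hnc, hc⟩ := htouch wc hsc (by omega) (by omega)
  refine ⟨turnCount (E.bcBondConfig Set.univ) (startCorner hE) nc, fun w hs hd => ?_⟩
  -- Step 2 (c): induction outwards from the centre — every window site at column distance `≤ 2m`
  -- from the centre is touched in the all-open configuration with turn count `τ`
  have key : ∀ (m : ℕ) (w : Site 2), w 0 + w 1 = L - 2 → 2 * (w 0 - w 1) ≤ L + 2 →
      -(L + 2) ≤ 2 * (w 0 - w 1) → w 0 - w 1 - (wc 0 - wc 1) ≤ 2 * m → wc 0 - wc 1 - (w 0 - w 1) ≤ 2 * m →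
      ∃ n < exitTime hE Set.univ, cornerOrbit (E.bcBondConfig Set.univ) (startCorner hE) n = (w, 0) ∧
        turnCount (E.bcBondConfig Set.univ) (startCorner hE) n =
          turnCount (E.bcBondConfig Set.univ) (startCorner hE) nc := by
    intro m
    induction m with
    | zero =>
      intro w hs hd1 hd2 hm1 hm2
      push_cast at hm1 hm2
      obtain rfl : w = wc := Site.eq_iff_two.2 ⟨by omega, by omega⟩
      exact ⟨nc, hnc, hc, rfl⟩
    | succ m ih =>
      intro w hs hd1 hd2 hm1 hm2
      push_cast at hm1 hm2
      by_cases hle : w 0 - w 1 - (wc 0 - wc 1) ≤ 2 * m ∧ wc 0 - wc 1 - (w 0 - w 1) ≤ 2 * m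
      · exact ih w hs hd1 hd2 hle.1 hle.2
      obtain ⟨n, hn, h⟩ := htouch w hs hd1 hd2
      refine ⟨n, hn, h, ?_⟩
      obtain ⟨-, -, -, -, -, -, -, -, -, -, f0, f1, g0, g1⟩ := wall_coords w
      -- by parity (`d ≡ L ≡ d_c (mod 2)`) the column distance is exactly `2m + 2`
      rcases (show w 0 - w 1 - (wc 0 - wc 1) = 2 * m + 2 ∨ wc 0 - wc 1 - (w 0 - w 1) = 2 * m + 2 by omega)
        with hm | hm
      · -- right of the centre: compare with the touch of `w - e₀ + e₁`, one window step inwards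
        obtain ⟨n', hn', h', htc'⟩ := ih (w - cornerUnit 0 + cornerUnit 1) (by rw [f0, f1]; omega)
          (by rw [f0, f1]; omega) (by rw [f0, f1]; omega) (by rw [f0, f1]; omega) (by rw [f0, f1]; omega)
        rw [← htc']
        exact turnCount_shift_univ hE hH hL hmesh hadj hbd hface harcB hs hd1 (by omega) hn hn' h h'
      · -- left of the centre: compare with the touch of `w + e₀ - e₁`, one window step inwards
        obtain ⟨n', hn', h', htc'⟩ := ih (w + cornerUnit 0 - cornerUnit 1) (by rw [g0, g1]; omega)
          (by rw [g0, g1]; omega) (by rw [g0, g1]; omega) (by rw [g0, g1]; omega) (by rw [g0, g1]; omega)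
        rw [← htc']
        have hw : w + cornerUnit 0 - cornerUnit 1 - cornerUnit 0 + cornerUnit 1 = w := by abel
        exact (turnCount_shift_univ hE hH hL hmesh hadj hbd hface harcB (w := w + cornerUnit 0 - cornerUnit 1)
          (by rw [g0, g1]; omega) (by rw [g0, g1]; omega) (by rw [g0, g1]; omega) hn' hn h'
          (by rw [hw]; exact h)).symm
  -- Step 2 (d): TouchPhase transfers `τ` to every touch of `w` in every configuration
  rw [two_mul_abs_le] at hd
  obtain ⟨hd1, hd2⟩ := hd
  obtain ⟨hw, hw1, -, hw', hB0, hB1, hu, hwA, -, -⟩ := wall_site hL hmesh hadj hbd hface harcB hs hd1 hd2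
  obtain ⟨M, hM⟩ := Int.eq_ofNat_of_zero_le (show (0 : ℤ) ≤ L by omega)
  obtain ⟨n₁, hn₁, h₁, htc₁⟩ := key M w hs hd1 hd2 (by omega) (by omega)
  have hτ : ∀ (ω : BondConfig (Site 2)) (n : ℕ), n < exitTime hE ω →
      cornerOrbit (E.bcBondConfig ω) (startCorner hE) n = (w, 0) →
      turnCount (E.bcBondConfig ω) (startCorner hE) n = turnCount (E.bcBondConfig Set.univ) (startCorner hE) nc :=
    fun ω n hn h => by rw [← htc₁]; exact turnCount_touch hE hH hw hw' hu hn hn₁ h h₁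
  -- Step 3: the two flux darts, on the event `{touch} = {w ↔ A}`
  have hset : {ω : BondConfig (Site 2) | ∃ n < exitTime hE ω,
      cornerOrbit (E.bcBondConfig ω) (startCorner hE) n = (w, 0)} =
      {ω : BondConfig (Site 2) | ∃ a ∈ E.zdArcA, (SimpleGraph.fromEdgeSet (E.bcBondConfig ω)).Reachable w a} :=
    Set.ext fun ω => touch_iff hE hH hw hw' hu
  have h1 := cornerObs_touch_out hE hw hw1 hB0 hB1 hwA _ hτ
  have h2 := cornerObs_touch_in hE hw hw1 hB0 hB1 hwA _ hτ
  rw [hset] at h1 h2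
  exact ⟨h1, h2⟩

end S5

end Summit.CriticalPhenomena.CardyFormulaZ2.Theorems.ParafermionFamiliesToSLESix.StripAnchored

end
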